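import Summits.QuantumFields.BalabanUV.Beta.GAN24.ExponentialChartBaseTower
import Summits.QuantumFields.BalabanUV.Beta.GAN24.ExponentialChartBaseCovariantTaylor
import Summits.QuantumFields.BalabanUV.Beta.GAN24.ExponentialChartBaseHessianMoments

/-!
# `BalabanUV.Beta.GAN24.ExponentialChartBaseHessianDiag` — binder row G-an2-4 ∕ (CONV-C), route R7 «TWO CURRENCIES», leaf lane (η′) «THE ONE-PARAMETER TOWER AT THE BASE POINT», PART 4:
# THE DIAGONAL OF THE ONE-LOOP HESSIAN AT A BASE POINT IS THE ONE-PARAMETER `N = 2` OBJECT.  Road-P3's PART 268 (`deriv_deriv_invCov_expChartAt₂_eq_mixedDiagram`: the mixed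
# partial `∂_r|₀∂_s|₀` along `exp(iη(A₀ + sA + rB))` = five diagrams with perturbed propagators) at `B = A = X` and PART 3 (`iteratedDeriv_two_invCov_expChartAt_eq`: `∂²_s|₀` along
# `exp(iη(A₀ + sX))` = `2·E₀X_aE₀X_aE₀ − 2·E₀X_{aa}E₀ + E₀X_{p₂}E₀`) have THE SAME LETTERS (PART 3's letters were typed in PART 268's shapes), hence `hessianAt X X = ∂²_s|₀` by
# `two_smul` + `abel` — PART 257's `hessian_diag` at the base point; the two invertibilities displayed as in PARTs 268 ∕ 270 (unit b2b-balaban-gan24-formalise-leaf-01, gen 94; v1;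
# road-P3 g67's cut (η′), journal l.68353; generator `HOME/b2b-balaban-gan24-formalise-leaf-01/g94/tools/gen/gen_diag.py`)

NOT IN PRINT; OUR PROOF ([folklore] bookkeeping BY NAME over PART 268 (`deriv_deriv_invCov_expChartAt₂_eq_mixedDiagram`) and PART 3 (`iteratedDeriv_two_invCov_expChartAt_eq`);
[Balaban1985BackgroundPropagators] (3.3) p. 390, (3.35) p. 396 and [Balaban1987RG1] (1.20)–(1.22) p. 264 LOCATE the shapes; nothing printed is a hypothesis).
HONEST FRAMING (cell contract, verbatim): «discharging `BetaPertH` makes Bałaban's UV stability UNCONDITIONAL — a real constructive-QFT result; it is NOT the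
continuum limit and NOT the Clay problem.»  HONEST DEPENDENCY (verbatim): «continuum YM on T⁴ ⇐ BetaPertH ∧ nine spine estimates (0/9 proved); BetaPertH ⇐
(D1) ∧ (D4) ∧ CAP+tail; G-an2-4 gates asym, D1 and NE2/3/4.»

WHAT THIS FILE PROVES (0 sorry, 0 `def`; every volume `M`, every level `k`, real `A₀, X`):
* **`hessianAt_diag`** — `∂_r|₀∂_s|₀[(L^{dk}Q_k(Δ_a + covPert exp(iη(A₀ + sX + rX)))⁻¹Q_kᴴ)⁻¹] = ∂²_s|₀[(L^{dk}Q_k(Δ_a + covPert exp(iη(A₀ + sX)))⁻¹Q_kᴴ)⁻¹]`, invertibility of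
  `Δ_a + (Δ^{U₀} − Δ^1)` and of `c_k(U₀)` displayed.
WHAT IT DOES NOT DO: the END (PART 2∕2 at `N = 2` ∕ road-P3's PART 269); anything beyond bookkeeping.  SUPPLIER work; NEVER «G-an2-4 closed»; NOT (CONV-C), NOT D1, NOT `BetaPertH`,
NOT continuum, NOT Clay.  Records: `HOME/b2b-balaban-gan24-formalise-leaf-01/g94/README-g94.md`.
-/

noncomputable section

open scoped BigOperators ComplexConjugate Matrix Matrix.Norms.L2Operator
open Filter Topology

namespace Summit.QuantumFields.BalabanUV.Beta.GAN24.ExponentialChartBaseHessianDiag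

open Literature.MathematicalPhysics.QuantumFieldTheory.Balaban1983to89
open Literature.MathematicalPhysics.QuantumFieldTheory.Balaban1983to89.B5Prop11Plancherel (Tor fine)
open Literature.MathematicalPhysics.QuantumFieldTheory.Balaban1983to89.B5G183RateUnitTower (lev)
open Summit.QuantumFields.BalabanUV.T4Continuum
open Summit.QuantumFields.BalabanUV.T4Continuum.CovariantAveragingTower (avgTow)
open Summit.QuantumFields.BalabanUV.T4Continuum.BalabanAveragedTowerUnit (idx QBlev)
open Summit.QuantumFields.BalabanUV.T4Continuum.KingPairingPlantedLaw (calDalev)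
open Summit.QuantumFields.BalabanUV.T4Continuum.AbelianCovariantLaplacian (covPert)
open Summit.QuantumFields.BalabanUV.Beta.GAN24.ExponentialChartBaseCovariantTaylor (deriv_deriv_invCov_expChartAt₂_eq_mixedDiagram)
open Summit.QuantumFields.BalabanUV.Beta.GAN24.ExponentialChartBaseTower (iteratedDeriv_two_invCov_expChartAt_eq)

variable {d : ℕ} (L : ℕ) [NeZero L] (M : Fin d → ℕ) [hM : ∀ μ, NeZero (M μ)] (a : ℝ) (ha : 0 < a)

/-- **`hessianAt_diag` — THE DIAGONAL OF THE ONE-LOOP HESSIAN AT A NONZERO SMALL REAL BASE CONNECTION IS THE ONE-PARAMETER `N = 2` OBJECT** [our proof]: for every volume, every level `k`,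
real `A₀, X`, whenever `Δ_a^{(k)} + (Δ^{U₀} − Δ^1)^{(k)}` and `c_k(U₀)` are invertible (displayed, as in PARTs 268 ∕ 270),
`∂_r|₀∂_s|₀[(L^{dk}Q_k(Δ_a^{(k)} + covPert exp(iη(A₀ + sX + rX)) k)⁻¹Q_kᴴ)⁻¹] = ∂²_s|₀[(L^{dk}Q_k(Δ_a^{(k)} + covPert exp(iη(A₀ + sX)) k)⁻¹Q_kᴴ)⁻¹]` — road-P3's `hessianAt X X` is PART 3's bubble − tadpole
combination (PART 268 at `B = A = X`, PART 3, `two_smul`, `abel`).  PART 257's `hessian_diag` is `A₀ = 0`.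
[cite: Balaban1985BackgroundPropagators, (3.3) p.390, (3.35) p.396 (shapes); Balaban1987RG1, (1.20)–(1.22) p.264 (shapes)] -/
theorem hessianAt_diag (A₀ X : (k : ℕ) → Fin d → (idx L M k → ℝ)) (k : ℕ)
    (h0 : IsUnit (calDalev L M a ha k + covPert L M (fun k'' ν' (x' : idx L M k'') => Complex.exp (Complex.I * ((A₀ k'' ν' x' : ℝ) : ℂ) / ((lev L k'' : ℕ) : ℂ))) k).det)
    (hc0 : IsUnit (avgTow (QBlev L M) ((L : ℝ) ^ d) (fun k' => (calDalev L M a ha k' + covPert L M (fun k'' ν' (x' : idx L M k'') => Complex.exp (Complex.I * ((A₀ k'' ν' x' : ℝ) :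
            ℂ) / ((lev L k'' : ℕ) : ℂ))) k')⁻¹) k).det) :
    deriv (fun r : ℝ => deriv (fun s : ℝ => (avgTow (QBlev L M) ((L : ℝ) ^ d)
        (fun k' => (calDalev L M a ha k' + covPert L M (fun k'' ν' (x' : idx L M k'') => Complex.exp (Complex.I * (A₀ k'' ν' x' : ℂ) / ((lev L k'' : ℕ) : ℂ) + (Complex.I * (X k''
                ν' x' : ℂ) / ((lev L k'' : ℕ) : ℂ)) * ((s : ℝ) : ℂ) + (Complex.I * (X k'' ν' x' : ℂ) / ((lev L k'' : ℕ) : ℂ)) * ((r : ℝ) : ℂ))) k')⁻¹) k)⁻¹) 0) 0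
      = iteratedDeriv 2 (fun s : ℝ => (avgTow (QBlev L M) ((L : ℝ) ^ d)
        (fun k' => (calDalev L M a ha k' + covPert L M (fun k'' ν' (x' : idx L M k'') => Complex.exp (Complex.I * ((A₀ k'' ν' x' : ℝ) : ℂ) / ((lev L k'' : ℕ) : ℂ) + (Complex.I *
                ((X k'' ν' x' : ℝ) : ℂ) / ((lev L k'' : ℕ) : ℂ)) * ((s : ℝ) : ℂ))) k')⁻¹) k)⁻¹) 0 := by
  rw [deriv_deriv_invCov_expChartAt₂_eq_mixedDiagram L M a ha A₀ X X k h0 hc0, iteratedDeriv_two_invCov_expChartAt_eq L M a ha A₀ X k h0 hc0, two_smul, two_smul]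
  abel

/-! ## ROAD-P3 APPENDIX (v2, append-only; unit b2b-balaban-gan24-p3, gen 67, PART 274; generator `HOME/b2b-balaban-gan24-p3/gen67/records/gen/gen274v2.py`)
THE DIAGONAL WITH NO HYPOTHESIS, AND ITS LIMIT KERNELS ∕ β-TYPE NUMBERS.  The chart is additive in its parameters: `exp(iη(A₀ + sA + rA)) = exp(iη(A₀ + (s + r)A))` entrywise, so
`(s, r) ↦ c_k(U_{s,r})⁻¹` is `(s, r) ↦ g(s + r)` with `g(u) = c_k(exp(iη(A₀ + uA)))⁻¹`, and `∂_r|₀∂_s|₀ g(s + r) = g″(0)` for EVERY `g` (translation invariance of `deriv`, Mathlib's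
`deriv_comp_add_const` — no differentiability hypothesis; then `iteratedDeriv_succ`).  Hence **`hessianAt_diag_shift`**: the identity of `hessianAt_diag` above with NO invertibility
hypothesis (every volume); `hessianAt_diag_eq_tower`: `= 2·E₀X_aE₀X_aE₀ − 2·E₀X_{aa}E₀ + E₀X_{p₂}E₀` under the invertibility (PART 3's right-hand side verbatim); and for ANY
infinite-volume limit kernels `Π` of road-P3 PART 269's family of `(A, A)` and `Π⁽²⁾` of PART 2∕2's `N = 2` family: **`hessianAtKernel_diag`** (`Π = Π⁽²⁾` pointwise),
**`hessianAtMoments_diag`** (level numbers, telescoped limit kernels, limit numbers agree) — NO hypothesis — and **`exists_hessianAtMoments_diag_of_tendsto`** over the two ENDs,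
displaying only `(α, β)` + EL₁ of `A` and the base constants ∕ EL₁ on the disc.  [folklore] bookkeeping BY NAME (Mathlib's `deriv_comp_add_const`, `iteratedDeriv_succ ∕ _one`,
`tendsto_nhds_unique`; PART 3 `iteratedDeriv_two_invCov_expChartAt_eq`; PART 2∕2 `conv_iteratedDeriv_invCov_expChartAt_of_tendsto`; road-P3 PART 269
`conv_deriv_deriv_invCov_expChartAt₂_of_tendsto`; PART 259 §1 `secondMoment_congr ∕ limKernelOf_congr_apply ∕ secondMoment_limKernelOf_congr`); nothing printed is a hypothesis;
NEVER «G-an2-4 closed»; NOT (CONV-C), NOT D1, NOT `BetaPertH`, NOT continuum, NOT Clay.  Records: `HOME/b2b-balaban-gan24-p3/gen67/README.md`. -/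

open Literature.MathematicalPhysics.QuantumFieldTheory.Balaban1983to89.B5Prop11Plancherel (Cst)
open Literature.MathematicalPhysics.QuantumFieldTheory.Balaban1983to89.Beta (Site IsInfiniteVolumeLimit)
open Literature.MathematicalPhysics.QuantumFieldTheory.Balaban1983to89.Beta.FreeLegDictionary (cubic)
open Literature.MathematicalPhysics.QuantumFieldTheory.Balaban1983to89.Beta.BlockKernelVolumeSockets (evenPeriod)
open Literature.MathematicalPhysics.QuantumFieldTheory.Balaban1983to89.Beta.VectorTails (castT)
open Literature.MathematicalPhysics.QuantumFieldTheory.Balaban1983to89.Beta.LimitRate (limKernelOf)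
open Summit.QuantumFields.BalabanUV.T4Continuum.BalabanAveragedCoerciveTower (unitIdx)
open Summit.QuantumFields.BalabanUV.T4Continuum.BalabanAveragedCoercive (gammaB)
open Summit.QuantumFields.BalabanUV.T4Continuum.FirstOrderBackgroundModel (LipschitzBackground Pmodel)
open Summit.QuantumFields.BalabanUV.T4Continuum.PerturbationAlgebra (BoundedBackground)
open Summit.QuantumFields.BalabanUV.T4Continuum.AbelianCovariantLaplacian (connV zT)
open Summit.QuantumFields.BalabanUV.T4Continuum.CTConjugatedHbd (G2)
open Summit.QuantumFields.BalabanUV.T4Continuum.DirichletRegionTower (gamD)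
open Summit.QuantumFields.BalabanUV.T4Continuum.ScalarAveragedPropagator (gammaPs)
open Summit.QuantumFields.BalabanUV.T4Continuum.ScalarAveragedCompression (sigma0)
open Summit.QuantumFields.BalabanUV.T4Continuum.CTScalarGreen (Jfree)
open Summit.QuantumFields.BalabanUV.T4Continuum.CTGaugeTerm (deltaK)
open Summit.QuantumFields.BalabanUV.T4Continuum.CTVectorPropagator (JA)
open Summit.QuantumFields.BalabanUV.Beta.GAN24.ExponentialChartHessianMoments (secondMoment_congr limKernelOf_congr_apply secondMoment_limKernelOf_congr)
open Summit.QuantumFields.BalabanUV.Beta.GAN24.ExponentialChartBaseCovariantTaylorEnd (conv_deriv_deriv_invCov_expChartAt₂_of_tendsto)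
open Summit.QuantumFields.BalabanUV.Beta.GAN24.ExponentialChartBaseCovariantTaylorLine (conv_iteratedDeriv_invCov_expChartAt_of_tendsto)

/-! ## §A0 GENERIC: the mixed partial of `(s, r) ↦ g(s + r)` at the origin is `g″(0)` — no hypothesis -/

/-- **`deriv_deriv_comp_add_eq_iteratedDeriv_two`** — for EVERY `g : ℝ → F` (real normed space): `∂_r|₀ ∂_s|₀ g(s + r) = iteratedDeriv 2 g 0`.  Translation invariance of `deriv`
(`deriv (g(· + r)) 0 = deriv g r`, Mathlib's `deriv_comp_add_const`, valid with no differentiability hypothesis) and `iteratedDeriv_succ`. [folklore] -/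
theorem deriv_deriv_comp_add_eq_iteratedDeriv_two {F : Type*} [NormedAddCommGroup F] [NormedSpace ℝ F] (g : ℝ → F) :
    deriv (fun r : ℝ => deriv (fun s : ℝ => g (s + r)) 0) 0 = iteratedDeriv 2 g 0 := by
  have h : ∀ r : ℝ, deriv (fun s : ℝ => g (s + r)) 0 = deriv g r := fun r => by
    rw [deriv_comp_add_const, zero_add]
  simp only [h]
  rw [iteratedDeriv_succ, iteratedDeriv_one]

/-! ## §A1 The diagonal of the Hessian at `U₀` is the second derivative along the one-parameter chart — every volume, NO hypothesis -/

/-- **`hessianAt_diag_shift` — THE DIAGONAL OF THE HESSIAN AT `U₀` IS `∂²_s|₀` ALONG THE CHART, WITH NO HYPOTHESIS** [our proof]: for every volume, every level `k`, REAL `A₀, A`: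
`∂_r|₀∂_s|₀[(L^{dk}Q_k(Δ_a + (Δ^{exp(iη(A₀ + sA + rA))} − Δ^1))⁻¹Q_kᴴ)⁻¹] = ∂²_s|₀[(L^{dk}Q_k(Δ_a + (Δ^{exp(iη(A₀ + sA))} − Δ^1))⁻¹Q_kᴴ)⁻¹]` — the chart is `exp(iη(A₀ + (s + r)A))`
entrywise (`push_cast; ring` under `Complex.exp`) and §A0 applies to `g(u) = c_k(exp(iη(A₀ + uA)))⁻¹`; no invertibility, no differentiability is used. -/
theorem hessianAt_diag_shift (A₀ A : (k : ℕ) → Fin d → (idx L M k → ℝ)) (k : ℕ) :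
    deriv (fun r : ℝ => deriv (fun s : ℝ => (avgTow (QBlev L M) ((L : ℝ) ^ d)
        (fun k' => (calDalev L M a ha k' + covPert L M (fun k'' ν' (x' : idx L M k'') => Complex.exp (Complex.I * (A₀ k'' ν' x' : ℂ) / ((lev L k'' : ℕ) : ℂ) + (Complex.I * (A k'' ν' x' : ℂ)
              / ((lev L k'' : ℕ) : ℂ)) * ((s : ℝ) : ℂ) + (Complex.I * (A k'' ν' x' : ℂ) / ((lev L k'' : ℕ) : ℂ)) * ((r : ℝ) : ℂ))) k')⁻¹) k)⁻¹) 0) 0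
      = iteratedDeriv 2 (fun s : ℝ => (avgTow (QBlev L M) ((L : ℝ) ^ d)
          (fun k' => (calDalev L M a ha k' + covPert L M (fun k'' ν' (x' : idx L M k'') => Complex.exp (Complex.I * (A₀ k'' ν' x' : ℂ) / ((lev L k'' : ℕ) : ℂ) + (Complex.I *
                  (A k'' ν' x' : ℂ) / ((lev L k'' : ℕ) : ℂ)) * ((s : ℝ) : ℂ))) k')⁻¹) k)⁻¹) 0 := by
  have hU : ∀ s r : ℝ, (fun k'' ν' (x' : idx L M k'') => Complex.exp (Complex.I * (A₀ k'' ν' x' : ℂ) / ((lev L k'' : ℕ) : ℂ) + (Complex.I * (A k'' ν' x' : ℂ) / ((lev L k'' : ℕ) : ℂ)) * ((s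
        : ℝ) : ℂ)
        + (Complex.I * (A k'' ν' x' : ℂ) / ((lev L k'' : ℕ) : ℂ)) * ((r : ℝ) : ℂ)))
      = fun k'' ν' (x' : idx L M k'') => Complex.exp (Complex.I * (A₀ k'' ν' x' : ℂ) / ((lev L k'' : ℕ) : ℂ) + (Complex.I * (A k'' ν' x' : ℂ) / ((lev L k'' : ℕ) : ℂ)) * (((s + r : ℝ)) : ℂ))
            := by
    intro s r
    funext k'' ν' x'
    push_cast
    ring_nf
  simp only [hU]
  exact deriv_deriv_comp_add_eq_iteratedDeriv_two (fun s : ℝ => (avgTow (QBlev L M) ((L : ℝ) ^ d)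
          (fun k' => (calDalev L M a ha k' + covPert L M (fun k'' ν' (x' : idx L M k'') => Complex.exp (Complex.I * (A₀ k'' ν' x' : ℂ) / ((lev L k'' : ℕ) : ℂ) + (Complex.I *
                  (A k'' ν' x' : ℂ) / ((lev L k'' : ℕ) : ℂ)) * ((s : ℝ) : ℂ))) k')⁻¹) k)⁻¹)

/-- `hessianAt_diag_eq_tower` — under the displayed invertibility of `Δ_a + (Δ^{U₀} − Δ^1)` and `c_k(U₀)`, the diagonal of the Hessian at `U₀` is leaf-01's explicit `N = 2` tower
`2·E₀X_aE₀X_aE₀ − 2·E₀X_{aa}E₀ + E₀X_{p₂}E₀` with PERTURBED propagators (`hessianAt_diag_shift` + `ExponentialChartBaseTower.iteratedDeriv_two_invCov_expChartAt_eq`, right-hand side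
      verbatim).
[our proof] -/
theorem hessianAt_diag_eq_tower (A₀ X : (k : ℕ) → Fin d → (idx L M k → ℝ)) (k : ℕ)
    (h0 : IsUnit (calDalev L M a ha k + covPert L M (fun k'' ν' (x' : idx L M k'') => Complex.exp (Complex.I * ((A₀ k'' ν' x' : ℝ) : ℂ) / ((lev L k'' : ℕ) : ℂ))) k).det)
    (hc0 : IsUnit (avgTow (QBlev L M) ((L : ℝ) ^ d) (fun k' => (calDalev L M a ha k' + covPert L M (fun k'' ν' (x' : idx L M k'') => Complex.exp (Complex.I * ((A₀ k'' ν' x' : ℝ) :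
            ℂ) / ((lev L k'' : ℕ) : ℂ))) k')⁻¹) k).det) :
    deriv (fun r : ℝ => deriv (fun s : ℝ => (avgTow (QBlev L M) ((L : ℝ) ^ d)
        (fun k' => (calDalev L M a ha k' + covPert L M (fun k'' ν' (x' : idx L M k'') => Complex.exp (Complex.I * (A₀ k'' ν' x' : ℂ) / ((lev L k'' : ℕ) : ℂ) + (Complex.I * (X k'' ν' x' : ℂ)
              / ((lev L k'' : ℕ) : ℂ)) * ((s : ℝ) : ℂ) + (Complex.I * (X k'' ν' x' : ℂ) / ((lev L k'' : ℕ) : ℂ)) * ((r : ℝ) : ℂ))) k')⁻¹) k)⁻¹) 0) 0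
      =
      (2 : ℂ) • ((avgTow (QBlev L M) ((L : ℝ) ^ d) (fun k' => (calDalev L M a ha k' + covPert L M (fun k'' ν' (x' : idx L M k'') => Complex.exp (Complex.I * ((A₀ k'' ν' x' : ℝ) :
              ℂ) / ((lev L k'' : ℕ) : ℂ))) k')⁻¹) k)⁻¹ * avgTow (QBlev L M) ((L : ℝ) ^ d) (fun k' => (calDalev L M a ha k' + covPert L M (fun k'' ν' (x' : idx L M k'') =>
              Complex.exp (Complex.I * ((A₀ k'' ν' x' : ℝ) : ℂ) / ((lev L k'' : ℕ) : ℂ))) k')⁻¹ * (Pmodel L M (fun k'' ν' (x' : idx L M k'') => -(Complex.I * ((X k'' ν' x' : ℝ) :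
              ℂ)) * Complex.exp (Complex.I * ((A₀ k'' ν' x' : ℝ) : ℂ) / ((lev L k'' : ℕ) : ℂ))) k' + (Pmodel L M (fun k'' ν' (x' : idx L M k'') => -(Complex.I * ((X k'' ν' x' : ℝ)
              : ℂ)) * Complex.exp (Complex.I * ((A₀ k'' ν' x' : ℝ) : ℂ) / ((lev L k'' : ℕ) : ℂ))) k')ᴴ + Matrix.diagonal ((fun (k'' : ℕ) (x' : idx L M k'') => -((lev L k'' : ℕ) :
              ℂ) * ∑ ν, (Complex.I * ((X k'' ν x' : ℝ) : ℂ)) * (Complex.exp (Complex.I * ((A₀ k'' ν x' : ℝ) : ℂ) / ((lev L k'' : ℕ) : ℂ)) - Complex.exp (-(Complex.I * ((A₀ k'' ν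
              x' : ℝ) : ℂ) / ((lev L k'' : ℕ) : ℂ))))) k')) * (calDalev L M a ha k' + covPert L M (fun k'' ν' (x' : idx L M k'') => Complex.exp (Complex.I * ((A₀ k'' ν' x' : ℝ) :
              ℂ) / ((lev L k'' : ℕ) : ℂ))) k')⁻¹) k
          * (avgTow (QBlev L M) ((L : ℝ) ^ d) (fun k' => (calDalev L M a ha k' + covPert L M (fun k'' ν' (x' : idx L M k'') => Complex.exp (Complex.I * ((A₀ k'' ν' x' : ℝ) : ℂ) /
                  ((lev L k'' : ℕ) : ℂ))) k')⁻¹) k)⁻¹ * avgTow (QBlev L M) ((L : ℝ) ^ d) (fun k' => (calDalev L M a ha k' + covPert L M (fun k'' ν' (x' : idx L M k'') =>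
                  Complex.exp (Complex.I * ((A₀ k'' ν' x' : ℝ) : ℂ) / ((lev L k'' : ℕ) : ℂ))) k')⁻¹ * (Pmodel L M (fun k'' ν' (x' : idx L M k'') => -(Complex.I * ((X k'' ν' x' :
                  ℝ) : ℂ)) * Complex.exp (Complex.I * ((A₀ k'' ν' x' : ℝ) : ℂ) / ((lev L k'' : ℕ) : ℂ))) k' + (Pmodel L M (fun k'' ν' (x' : idx L M k'') => -(Complex.I * ((X k''
                  ν' x' : ℝ) : ℂ)) * Complex.exp (Complex.I * ((A₀ k'' ν' x' : ℝ) : ℂ) / ((lev L k'' : ℕ) : ℂ))) k')ᴴ + Matrix.diagonal ((fun (k'' : ℕ) (x' : idx L M k'') =>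
                  -((lev L k'' : ℕ) : ℂ) * ∑ ν, (Complex.I * ((X k'' ν x' : ℝ) : ℂ)) * (Complex.exp (Complex.I * ((A₀ k'' ν x' : ℝ) : ℂ) / ((lev L k'' : ℕ) : ℂ)) - Complex.exp
                  (-(Complex.I * ((A₀ k'' ν x' : ℝ) : ℂ) / ((lev L k'' : ℕ) : ℂ))))) k')) * (calDalev L M a ha k' + covPert L M (fun k'' ν' (x' : idx L M k'') => Complex.exp
                  (Complex.I * ((A₀ k'' ν' x' : ℝ) : ℂ) / ((lev L k'' : ℕ) : ℂ))) k')⁻¹) k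
          * (avgTow (QBlev L M) ((L : ℝ) ^ d) (fun k' => (calDalev L M a ha k' + covPert L M (fun k'' ν' (x' : idx L M k'') => Complex.exp (Complex.I * ((A₀ k'' ν' x' : ℝ) : ℂ) /
                  ((lev L k'' : ℕ) : ℂ))) k')⁻¹) k)⁻¹)
        - (2 : ℂ) • ((avgTow (QBlev L M) ((L : ℝ) ^ d) (fun k' => (calDalev L M a ha k' + covPert L M (fun k'' ν' (x' : idx L M k'') => Complex.exp (Complex.I * ((A₀ k'' ν' x' :
                ℝ) : ℂ) / ((lev L k'' : ℕ) : ℂ))) k')⁻¹) k)⁻¹ * avgTow (QBlev L M) ((L : ℝ) ^ d) (fun k' => (calDalev L M a ha k' + covPert L M (fun k'' ν' (x' : idx L M k'') =>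
                Complex.exp (Complex.I * ((A₀ k'' ν' x' : ℝ) : ℂ) / ((lev L k'' : ℕ) : ℂ))) k')⁻¹ * (Pmodel L M (fun k'' ν' (x' : idx L M k'') => -(Complex.I * ((X k'' ν' x' : ℝ)
                : ℂ)) * Complex.exp (Complex.I * ((A₀ k'' ν' x' : ℝ) : ℂ) / ((lev L k'' : ℕ) : ℂ))) k' + (Pmodel L M (fun k'' ν' (x' : idx L M k'') => -(Complex.I * ((X k'' ν' x'
                : ℝ) : ℂ)) * Complex.exp (Complex.I * ((A₀ k'' ν' x' : ℝ) : ℂ) / ((lev L k'' : ℕ) : ℂ))) k')ᴴ + Matrix.diagonal ((fun (k'' : ℕ) (x' : idx L M k'') => -((lev L k''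
                : ℕ) : ℂ) * ∑ ν, (Complex.I * ((X k'' ν x' : ℝ) : ℂ)) * (Complex.exp (Complex.I * ((A₀ k'' ν x' : ℝ) : ℂ) / ((lev L k'' : ℕ) : ℂ)) - Complex.exp (-(Complex.I *
                ((A₀ k'' ν x' : ℝ) : ℂ) / ((lev L k'' : ℕ) : ℂ))))) k')) * ((calDalev L M a ha k' + covPert L M (fun k'' ν' (x' : idx L M k'') => Complex.exp (Complex.I * ((A₀ k''
                ν' x' : ℝ) : ℂ) / ((lev L k'' : ℕ) : ℂ))) k')⁻¹ * (Pmodel L M (fun k'' ν' (x' : idx L M k'') => -(Complex.I * ((X k'' ν' x' : ℝ) : ℂ)) * Complex.exp (Complex.I *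
                ((A₀ k'' ν' x' : ℝ) : ℂ) / ((lev L k'' : ℕ) : ℂ))) k' + (Pmodel L M (fun k'' ν' (x' : idx L M k'') => -(Complex.I * ((X k'' ν' x' : ℝ) : ℂ)) * Complex.exp
                (Complex.I * ((A₀ k'' ν' x' : ℝ) : ℂ) / ((lev L k'' : ℕ) : ℂ))) k')ᴴ + Matrix.diagonal ((fun (k'' : ℕ) (x' : idx L M k'') => -((lev L k'' : ℕ) : ℂ) * ∑ ν,
                (Complex.I * ((X k'' ν x' : ℝ) : ℂ)) * (Complex.exp (Complex.I * ((A₀ k'' ν x' : ℝ) : ℂ) / ((lev L k'' : ℕ) : ℂ)) - Complex.exp (-(Complex.I * ((A₀ k'' ν x' : ℝ) :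
                ℂ) / ((lev L k'' : ℕ) : ℂ))))) k')) * (calDalev L M a ha k' + covPert L M (fun k'' ν' (x' : idx L M k'') => Complex.exp (Complex.I * ((A₀ k'' ν' x' : ℝ) : ℂ) /
                ((lev L k'' : ℕ) : ℂ))) k')⁻¹)) k
          * (avgTow (QBlev L M) ((L : ℝ) ^ d) (fun k' => (calDalev L M a ha k' + covPert L M (fun k'' ν' (x' : idx L M k'') => Complex.exp (Complex.I * ((A₀ k'' ν' x' : ℝ) : ℂ) /
                  ((lev L k'' : ℕ) : ℂ))) k')⁻¹) k)⁻¹)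
        + (avgTow (QBlev L M) ((L : ℝ) ^ d) (fun k' => (calDalev L M a ha k' + covPert L M (fun k'' ν' (x' : idx L M k'') => Complex.exp (Complex.I * ((A₀ k'' ν' x' : ℝ) : ℂ) /
                ((lev L k'' : ℕ) : ℂ))) k')⁻¹) k)⁻¹ * avgTow (QBlev L M) ((L : ℝ) ^ d) (fun k' => (calDalev L M a ha k' + covPert L M (fun k'' ν' (x' : idx L M k'') => Complex.exp
                (Complex.I * ((A₀ k'' ν' x' : ℝ) : ℂ) / ((lev L k'' : ℕ) : ℂ))) k')⁻¹ * (Pmodel L M (fun k'' ν' (x' : idx L M k'') => -(Complex.I * ((X k'' ν' x' : ℝ) : ℂ)) *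
                (Complex.I * ((X k'' ν' x' : ℝ) : ℂ) / ((lev L k'' : ℕ) : ℂ)) * Complex.exp (Complex.I * ((A₀ k'' ν' x' : ℝ) : ℂ) / ((lev L k'' : ℕ) : ℂ))) k' + (Pmodel L M (fun
                k'' ν' (x' : idx L M k'') => -(Complex.I * ((X k'' ν' x' : ℝ) : ℂ)) * (Complex.I * ((X k'' ν' x' : ℝ) : ℂ) / ((lev L k'' : ℕ) : ℂ)) * Complex.exp (Complex.I * ((A₀
                k'' ν' x' : ℝ) : ℂ) / ((lev L k'' : ℕ) : ℂ))) k')ᴴ + Matrix.diagonal ((fun (k'' : ℕ) (x' : idx L M k'') => -∑ ν, (Complex.I * ((X k'' ν x' : ℝ) : ℂ)) * (Complex.I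
                * ((X k'' ν x' : ℝ) : ℂ)) * (Complex.exp (Complex.I * ((A₀ k'' ν x' : ℝ) : ℂ) / ((lev L k'' : ℕ) : ℂ)) + Complex.exp (-(Complex.I * ((A₀ k'' ν x' : ℝ) : ℂ) / ((lev
                L k'' : ℕ) : ℂ))))) k')) * (calDalev L M a ha k' + covPert L M (fun k'' ν' (x' : idx L M k'') => Complex.exp (Complex.I * ((A₀ k'' ν' x' : ℝ) : ℂ) / ((lev L k'' :
                ℕ) : ℂ))) k')⁻¹) k
          * (avgTow (QBlev L M) ((L : ℝ) ^ d) (fun k' => (calDalev L M a ha k' + covPert L M (fun k'' ν' (x' : idx L M k'') => Complex.exp (Complex.I * ((A₀ k'' ν' x' : ℝ) : ℂ) /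
                  ((lev L k'' : ℕ) : ℂ))) k')⁻¹) k)⁻¹ := by
  rw [hessianAt_diag_shift]
  exact iteratedDeriv_two_invCov_expChartAt_eq L M a ha A₀ X k h0 hc0


/-! ## §A2 The diagonal limit kernels at `U₀` are the `N = 2` tower's limit kernels (NO hypothesis) -/

section Kernels

/-- **`hessianAtKernel_diag` — THE DIAGONAL LIMIT KERNEL OF THE HESSIAN AT `U₀` IS THE `N = 2` LIMIT KERNEL**: if `Π` is an infinite-volume limit kernel of PART 269's family of
`(A, A)` at level `k` and `Π⁽²⁾` one of leaf-01's `N = 2` family `∂²_s|₀[(L^{dk}Q_k(Δ_a + covPert exp(iη(A₀,t + sA_t)))⁻¹Q_kᴴ)⁻¹]`, then `Π = Π⁽²⁾` pointwise (`hessianAt_diag_shift` volume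
      by
volume; limits are unique); NO hypothesis. [our proof] -/
theorem hessianAtKernel_diag {A₀ A : (t : ℕ) → (k : ℕ) → Fin d → (idx L (cubic d (evenPeriod t)) k → ℝ)} (k : ℕ) {P P2 : B12Beta.Kernel d}
    (h : IsInfiniteVolumeLimit evenPeriod
      (fun t μ' ν' (z : Site d (evenPeriod t)) =>
          ((deriv (fun r : ℝ => deriv (fun s : ℝ => (avgTow (QBlev L (cubic d (evenPeriod t))) ((L : ℝ) ^ d)
          (fun k' => (calDalev L (cubic d (evenPeriod t)) a ha k' + covPert L (cubic d (evenPeriod t)) (fun k'' ν' (x' : idx L (cubic d (evenPeriod t)) k'') => Complex.exp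
                (Complex.I * ((A₀ t) k'' ν' x' : ℂ) / ((lev L k'' : ℕ) : ℂ) + (Complex.I * ((A t) k'' ν' x' : ℂ) / ((lev L k'' : ℕ) : ℂ)) * ((s : ℝ) : ℂ) + (Complex.I * ((A t) k'' ν' x' :
                      ℂ) / ((lev L k'' : ℕ) : ℂ)) * ((r : ℝ) :
                ℂ))) k')⁻¹) k)⁻¹) 0) 0)
            ((unitIdx L (cubic d (evenPeriod t))).symm (z, μ')) ((unitIdx L (cubic d (evenPeriod t))).symm (0, ν'))).re) P)
    (h2 : IsInfiniteVolumeLimit evenPeriod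
      (fun t μ' ν' (z : Site d (evenPeriod t)) =>
          ((iteratedDeriv 2 (fun s : ℝ => (avgTow (QBlev L (cubic d (evenPeriod t))) ((L : ℝ) ^ d)
          (fun k' => (calDalev L (cubic d (evenPeriod t)) a ha k' + covPert L (cubic d (evenPeriod t)) (fun k'' ν' (x' : idx L (cubic d (evenPeriod t)) k'') => Complex.exp
                (Complex.I * ((A₀ t) k'' ν' x' : ℂ) / ((lev L k'' : ℕ) : ℂ) + (Complex.I * ((A t) k'' ν' x' : ℂ) / ((lev L k'' : ℕ) : ℂ)) * ((s : ℝ) : ℂ))) k')⁻¹) k)⁻¹) 0)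
            ((unitIdx L (cubic d (evenPeriod t))).symm (z, μ')) ((unitIdx L (cubic d (evenPeriod t))).symm (0, ν'))).re) P2) :
    ∀ μ ν (x : Fin d → ℤ), P μ ν x = P2 μ ν x := by
  intro μ ν x
  refine tendsto_nhds_unique (h μ ν x) ((h2 μ ν x).congr fun t => ?_)
  dsimp only
  rw [hessianAt_diag_shift L (cubic d (evenPeriod t)) a ha (A₀ t) (A t) k]

/-! ## §A3 The diagonal β-type numbers (NO hypothesis) -/

/-- **`hessianAtMoments_diag` — THE DIAGONAL β-TYPE NUMBERS AT `U₀` ARE THE `N = 2` TOWER's**: for ANY limit kernels `Π` of PART 269's family of `(A, A)` and `Π⁽²⁾` of leaf-01's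
`N = 2` family (every level): level numbers, telescoped limit kernels and limit numbers agree — NO hypothesis (`hessianAtKernel_diag` + PART 259 §1's congruences). [our proof] -/
theorem hessianAtMoments_diag {A₀ A : (t : ℕ) → (k : ℕ) → Fin d → (idx L (cubic d (evenPeriod t)) k → ℝ)} {P P2 : ℕ → B12Beta.Kernel d}
    (h : ∀ k, IsInfiniteVolumeLimit evenPeriod
      (fun t μ' ν' (z : Site d (evenPeriod t)) =>
          ((deriv (fun r : ℝ => deriv (fun s : ℝ => (avgTow (QBlev L (cubic d (evenPeriod t))) ((L : ℝ) ^ d)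
          (fun k' => (calDalev L (cubic d (evenPeriod t)) a ha k' + covPert L (cubic d (evenPeriod t)) (fun k'' ν' (x' : idx L (cubic d (evenPeriod t)) k'') => Complex.exp
                (Complex.I * ((A₀ t) k'' ν' x' : ℂ) / ((lev L k'' : ℕ) : ℂ) + (Complex.I * ((A t) k'' ν' x' : ℂ) / ((lev L k'' : ℕ) : ℂ)) * ((s : ℝ) : ℂ) + (Complex.I * ((A t) k'' ν' x' :
                      ℂ) / ((lev L k'' : ℕ) : ℂ)) * ((r : ℝ) :
                ℂ))) k')⁻¹) k)⁻¹) 0) 0)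
            ((unitIdx L (cubic d (evenPeriod t))).symm (z, μ')) ((unitIdx L (cubic d (evenPeriod t))).symm (0, ν'))).re) (P k))
    (h2 : ∀ k, IsInfiniteVolumeLimit evenPeriod
      (fun t μ' ν' (z : Site d (evenPeriod t)) =>
          ((iteratedDeriv 2 (fun s : ℝ => (avgTow (QBlev L (cubic d (evenPeriod t))) ((L : ℝ) ^ d)
          (fun k' => (calDalev L (cubic d (evenPeriod t)) a ha k' + covPert L (cubic d (evenPeriod t)) (fun k'' ν' (x' : idx L (cubic d (evenPeriod t)) k'') => Complex.exp
                (Complex.I * ((A₀ t) k'' ν' x' : ℂ) / ((lev L k'' : ℕ) : ℂ) + (Complex.I * ((A t) k'' ν' x' : ℂ) / ((lev L k'' : ℕ) : ℂ)) * ((s : ℝ) : ℂ))) k')⁻¹) k)⁻¹) 0)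
            ((unitIdx L (cubic d (evenPeriod t))).symm (z, μ')) ((unitIdx L (cubic d (evenPeriod t))).symm (0, ν'))).re) (P2 k)) :
    (∀ k μ ν, B12Beta.secondMoment (P k) μ ν = B12Beta.secondMoment (P2 k) μ ν) ∧ (∀ μ ν x, limKernelOf P μ ν x = limKernelOf P2 μ ν x) ∧
      ∀ μ ν, B12Beta.secondMoment (limKernelOf P) μ ν = B12Beta.secondMoment (limKernelOf P2) μ ν := by
  have e : ∀ k μ ν x, P k μ ν x = P2 k μ ν x := fun k => hessianAtKernel_diag L a ha k (h k) (h2 k)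
  exact ⟨fun k μ ν => secondMoment_congr (e k μ ν), fun μ ν x => limKernelOf_congr_apply fun k => e k μ ν x, fun μ ν => secondMoment_limKernelOf_congr fun k => e k μ ν⟩

/-! ## §A4 Over the two ENDs: displaying only `(α, β)` + EL₁ of `A` and the base constants on the disc -/

/-- **`exists_hessianAtMoments_diag_of_tendsto`** [our proof] (`d ≥ 3`, `L ≥ 2`, `a > 0`, `μ ≠ ν`, even cubic volumes): for a volume-indexed REAL direction `A` (`LipschitzBackground
(α, β)` uniformly in `t`, EL₁) and a REAL base family `A₀` (`connV U₀,t` Lipschitz `(α₀, β₀)` with EL₁, `zT U₀,t` bounded `(α₀′, β₀′)` with EL₁) on the three-condition disc at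
coupling `1`, PART 269 supplies limit kernels `Π` of the Hessian family of `(A, A)` at `U₀` and leaf-01's `ExponentialChartBaseCovariantTaylorLine` limit kernels `Π⁽²⁾` of the `N = 2`
family; by §A3 their β-type numbers agree at every level and at the limit. [cite: Balaban1985BackgroundPropagators, (3.3) p.390 (shapes); Balaban1987RG1, (1.20)–(1.22) p.264 (shapes)] -/
theorem exists_hessianAtMoments_diag_of_tendsto (hL : 2 ≤ L) (hd : 3 ≤ d) {μ ν : Fin d} (hne : μ ≠ ν) {α β α₀ β₀ α₀' β₀' a' κ : ℝ}
    (ha' : 0 < a') (hκ0 : 0 < κ)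
    (hγ' : Jfree d a' κ 1 < gammaPs d a') (hδ' : deltaK d a' κ 1 < sigma0 d a' ^ 2) (hJA : JA d a a' κ 1 < gamD d a)
    (hT₁ : 1 * (2 * (d * (α₀ + β₀) * Cst d a) + α₀' * Cst d a) ≤ 1 / 2)
    (hT₂ : 1 * (d * (α₀ * G2 d a (max (JA d a a' κ 1) 0) (gamD d a - max (JA d a a' κ 1) 0) κ)
      + d * (Real.exp |κ| * (α₀ * G2 d a (max (JA d a a' κ 1) 0) (gamD d a - max (JA d a a' κ 1) 0) κ + β₀ * (gamD d a - max (JA d a a' κ 1) 0)⁻¹))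
      + α₀' * (gamD d a - max (JA d a a' κ 1) 0)⁻¹) ≤ 1 / 2)
    (hT₃ : 4 * 1 * (2 * (d * (α₀ + β₀) * Cst d a) + α₀' * Cst d a) * Cst d a ≤ gammaB d a)
    {A₀ A : (t : ℕ) → (k : ℕ) → Fin d → (idx L (cubic d (evenPeriod t)) k → ℝ)}
    (hA : ∀ t, LipschitzBackground L (cubic d (evenPeriod t)) (fun k ν' x => (A t k ν' x : ℂ)) α β)
    (hw : ∀ t, LipschitzBackground L (cubic d (evenPeriod t)) (connV L (cubic d (evenPeriod t)) (fun k'' ν' (x' : idx L (cubic d (evenPeriod t)) k'') => Complex.exp (Complex.I * ((A₀ t) k''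
          ν' x' : ℂ) / ((lev L k'' : ℕ) : ℂ)))) α₀ β₀)
    (hz : ∀ t, BoundedBackground L (cubic d (evenPeriod t)) (zT L (cubic d (evenPeriod t)) (fun k'' ν' (x' : idx L (cubic d (evenPeriod t)) k'') => Complex.exp (Complex.I * ((A₀ t) k'' ν'
          x' : ℂ) / ((lev L k'' : ℕ) : ℂ)))) α₀' β₀')
    (hA1 : ∀ k (ν' f : Fin d) (z : Fin d → ℤ), ∃ s' : ℂ, Tendsto (fun t => ((A t k ν' (castT (cubic d (lev L k * evenPeriod t)) z, f) : ℝ) : ℂ)) atTop (𝓝 s'))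
    (hw1 : ∀ k (ν' f : Fin d) (z : Fin d → ℤ), ∃ s' : ℂ, Tendsto (fun t => connV L (cubic d (evenPeriod t)) (fun k'' ν' (x' : idx L (cubic d (evenPeriod t)) k'') => Complex.exp (Complex.I *
          ((A₀ t) k'' ν' x' : ℂ) / ((lev L k'' : ℕ) : ℂ))) k ν' (castT (cubic d (lev L k * evenPeriod t)) z, f)) atTop (𝓝 s'))
    (hz1 : ∀ k (f : Fin d) (z : Fin d → ℤ), ∃ s' : ℂ, Tendsto (fun t => zT L (cubic d (evenPeriod t)) (fun k'' ν' (x' : idx L (cubic d (evenPeriod t)) k'') => Complex.exp (Complex.I * ((A₀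
          t) k'' ν' x' : ℂ) / ((lev L k'' : ℕ) : ℂ))) k (castT (cubic d (lev L k * evenPeriod t)) z, f)) atTop (𝓝 s')) :
    ∃ P P2 : ℕ → B12Beta.Kernel d,
      (∀ k, IsInfiniteVolumeLimit evenPeriod
      (fun t μ' ν' (z : Site d (evenPeriod t)) =>
          ((deriv (fun r : ℝ => deriv (fun s : ℝ => (avgTow (QBlev L (cubic d (evenPeriod t))) ((L : ℝ) ^ d)
          (fun k' => (calDalev L (cubic d (evenPeriod t)) a ha k' + covPert L (cubic d (evenPeriod t)) (fun k'' ν' (x' : idx L (cubic d (evenPeriod t)) k'') => Complex.exp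
                (Complex.I * ((A₀ t) k'' ν' x' : ℂ) / ((lev L k'' : ℕ) : ℂ) + (Complex.I * ((A t) k'' ν' x' : ℂ) / ((lev L k'' : ℕ) : ℂ)) * ((s : ℝ) : ℂ) + (Complex.I * ((A t) k'' ν' x' :
                      ℂ) / ((lev L k'' : ℕ) : ℂ)) * ((r : ℝ) :
                ℂ))) k')⁻¹) k)⁻¹) 0) 0)
            ((unitIdx L (cubic d (evenPeriod t))).symm (z, μ')) ((unitIdx L (cubic d (evenPeriod t))).symm (0, ν'))).re) (P k)) ∧
      (∀ k, IsInfiniteVolumeLimit evenPeriod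
      (fun t μ' ν' (z : Site d (evenPeriod t)) =>
          ((iteratedDeriv 2 (fun s : ℝ => (avgTow (QBlev L (cubic d (evenPeriod t))) ((L : ℝ) ^ d)
          (fun k' => (calDalev L (cubic d (evenPeriod t)) a ha k' + covPert L (cubic d (evenPeriod t)) (fun k'' ν' (x' : idx L (cubic d (evenPeriod t)) k'') => Complex.exp
                (Complex.I * ((A₀ t) k'' ν' x' : ℂ) / ((lev L k'' : ℕ) : ℂ) + (Complex.I * ((A t) k'' ν' x' : ℂ) / ((lev L k'' : ℕ) : ℂ)) * ((s : ℝ) : ℂ))) k')⁻¹) k)⁻¹) 0)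
            ((unitIdx L (cubic d (evenPeriod t))).symm (z, μ')) ((unitIdx L (cubic d (evenPeriod t))).symm (0, ν'))).re) (P2 k)) ∧
      (∀ k μ' ν', B12Beta.secondMoment (P k) μ' ν' = B12Beta.secondMoment (P2 k) μ' ν') ∧
      ∀ μ' ν', B12Beta.secondMoment (limKernelOf P) μ' ν' = B12Beta.secondMoment (limKernelOf P2) μ' ν' := by
  obtain ⟨κ₁, C₁, C₁', -, -, -, P, hI, -, -, -, -⟩ :=
    conv_deriv_deriv_invCov_expChartAt₂_of_tendsto L a ha hL hd hne ha' hκ0 hγ' hδ' hJA hT₁ hT₂ hT₃ hA hA hw hz hA1 hA1 hw1 hz1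
  obtain ⟨κ₂, C₂, C₂', -, -, -, P2, hI2, -, -, -, -⟩ :=
    conv_iteratedDeriv_invCov_expChartAt_of_tendsto L a ha hL hd hne ha' hκ0 hγ' hδ' hJA hT₁ hT₂ hT₃ 2 hA hw hz hA1 hw1
  have hdiag := hessianAtMoments_diag L a ha hI hI2
  exact ⟨P, P2, hI, hI2, hdiag.1, hdiag.2.2⟩

end Kernels

end Summit.QuantumFields.BalabanUV.Beta.GAN24.ExponentialChartBaseHessianDiag

end
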